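import Summits.Ventures.PercRepro.MSTightDefect

/-!
# The block step: two near-members of a difference-closed family coincide

A family `F` with `F \\ F = insert ∅ F` (every difference is a member or empty — the «block»
families: a down-set in the lattice of block unions, minus `∅`) cannot carry two distinct
near-members `u`, `u'` for the same sign pattern whose mutual differences `u \ u'`, `u' \ u` are
differences of `F`: the set `u \ u'` would itself be a member, and the required cell of `u`
(agreement sign) or of `u'` (disagreement sign) at that member is `uᶜ` resp. `u'` — a non-member
(`eq_of_diffs_eq_insert_empty`). The mirror statement for `F \\ F = insert ∅ (F.image (univ \ ·))`
follows by complementing every set (`eq_of_diffs_eq_insert_empty_compl`). These are the last two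
steps of the «≤ 2 pairs» reduction of proofs/MINE1-theoremS.md, Addendum 3: with Lemma U
(`eq_of_cells_subset_insert`) and the tight-extension step (`mem_or_compl_mem_of_tight_insert`),
only Conjecture V — the block structure of the residue — separates the coloured Marica–Schönheim
statement with two pairs of some type from the kernel.
-/

namespace PercRepro.MSTight

open Finset
open scoped FinsetFamily

variable {α : Type*} [DecidableEq α] [Fintype α]

/-- In a family whose differences are members or `∅`, a near-member `u` and a near-member `u'`
(same sign pattern) with `u \ u'` a difference satisfy `u ⊆ u'`. -/
theorem subset_of_diffs_eq_insert_empty {F : Finset (Finset α)} (hD : F \\ F = insert ∅ F)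
    (σ : Finset α → Bool) {u u' : Finset α} (hu : u ∉ F) (huc : Finset.univ \ u ∉ F)
    (hu' : u' ∉ F) (hu'c : Finset.univ \ u' ∉ F)
    (h : ∀ t ∈ F, Cells (F \\ F) t (if σ t = true then u else Finset.univ \ u))
    (h' : ∀ t ∈ F, Cells (F \\ F) t (if σ t = true then u' else Finset.univ \ u'))
    (hx : u \ u' ∈ F \\ F) : u ⊆ u' := by
  by_contra hsub
  have hne : u \ u' ≠ ∅ := fun h0 => hsub (sdiff_eq_empty_iff_subset.1 h0)
  have hxF : u \ u' ∈ F := by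
    rw [hD] at hx
    exact (mem_insert.1 hx).resolve_left hne
  by_cases hσ : σ (u \ u') = true
  · -- the second agreement cell of `u` at the member `u \ u'` is `uᶜ`
    have hc := (h _ hxF).2
    rw [if_pos hσ] at hc
    have e : (Finset.univ \ (u \ u')) ∩ (Finset.univ \ u) = Finset.univ \ u := by
      ext x
      simp only [mem_inter, mem_sdiff, mem_univ, true_and, not_and, not_not]
      tauto
    rw [e, hD] at hc
    rcases mem_insert.1 hc with h0 | h0
    · -- `u = univ`, so `u \ u' = univ \ u'` would be a member
      have hu_univ : u = Finset.univ := by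
        rw [← Finset.sdiff_sdiff_eq_self (subset_univ u), h0, Finset.sdiff_empty]
      apply hu'c
      rw [← hu_univ]
      exact hxF
    · exact huc h0
  · -- the second disagreement cell of `u'` at the member `u \ u'` is `u'`
    have hc := (h' _ hxF).2
    rw [if_neg hσ, Finset.sdiff_sdiff_eq_self (subset_univ u')] at hc
    have e : (Finset.univ \ (u \ u')) ∩ u' = u' := by
      ext x
      simp only [mem_inter, mem_sdiff, mem_univ, true_and, not_and, not_not]
      tauto
    rw [e, hD] at hc
    rcases mem_insert.1 hc with h0 | h0
    · -- `u' = ∅`, so `u \ u' = u` would be a member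
      apply hu
      rw [h0, Finset.sdiff_empty] at hxF
      exact hxF
    · exact hu' h0

/-- **The block step.** In a family whose differences are members or `∅`, two near-members for
the same sign pattern whose mutual differences are differences coincide. -/
theorem eq_of_diffs_eq_insert_empty {F : Finset (Finset α)} (hD : F \\ F = insert ∅ F)
    (σ : Finset α → Bool) {u u' : Finset α} (hu : u ∉ F) (huc : Finset.univ \ u ∉ F)
    (hu' : u' ∉ F) (hu'c : Finset.univ \ u' ∉ F)
    (h : ∀ t ∈ F, Cells (F \\ F) t (if σ t = true then u else Finset.univ \ u))
    (h' : ∀ t ∈ F, Cells (F \\ F) t (if σ t = true then u' else Finset.univ \ u'))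
    (hx : u \ u' ∈ F \\ F) (hy : u' \ u ∈ F \\ F) : u' = u :=
  Finset.Subset.antisymm
    (subset_of_diffs_eq_insert_empty hD σ hu' hu'c hu huc h' h hy)
    (subset_of_diffs_eq_insert_empty hD σ hu huc hu' hu'c h h' hx)

/-- Complementing every set keeps the difference family. -/
theorem diffs_image_compl (F : Finset (Finset α)) :
    (F.image fun t => Finset.univ \ t) \\ (F.image fun t => Finset.univ \ t) = F \\ F := by
  ext E
  simp only [mem_diffs, mem_image]
  constructor
  · rintro ⟨_, ⟨A, hA, rfl⟩, _, ⟨B, hB, rfl⟩, rfl⟩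
    refine ⟨B, hB, A, hA, ?_⟩
    ext x; simp only [mem_sdiff, mem_univ, true_and, not_not]; tauto
  · rintro ⟨A, hA, B, hB, rfl⟩
    refine ⟨Finset.univ \ B, ⟨B, hB, rfl⟩, Finset.univ \ A, ⟨A, hA, rfl⟩, ?_⟩
    ext x; simp only [mem_sdiff, mem_univ, true_and, not_not]; tauto

/-- Membership in the complemented family. -/
theorem mem_image_compl_iff {F : Finset (Finset α)} {t : Finset α} :
    t ∈ F.image (fun s => Finset.univ \ s) ↔ Finset.univ \ t ∈ F := by
  constructor
  · rintro h
    obtain ⟨s, hs, rfl⟩ := mem_image.1 h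
    rwa [Finset.sdiff_sdiff_eq_self (subset_univ s)]
  · intro h
    exact mem_image.2 ⟨Finset.univ \ t, h, Finset.sdiff_sdiff_eq_self (subset_univ t)⟩

/-- The required cells of `v` at `t` are the required cells of `vᶜ` at `tᶜ` (in the other
order). -/
theorem cells_compl_iff (D : Finset (Finset α)) (t v : Finset α) :
    Cells D (Finset.univ \ t) (Finset.univ \ v) ↔ Cells D t v := by
  simp only [Cells, Finset.sdiff_sdiff_eq_self (subset_univ t),
    Finset.sdiff_sdiff_eq_self (subset_univ v)]
  exact and_comm

/-- **The block step, mirror form**: the same for a family whose differences are complements of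
members or `∅`. -/
theorem eq_of_diffs_eq_insert_empty_compl {F : Finset (Finset α)}
    (hD : F \\ F = insert ∅ (F.image fun t => Finset.univ \ t)) (σ : Finset α → Bool)
    {u u' : Finset α} (hu : u ∉ F) (huc : Finset.univ \ u ∉ F) (hu' : u' ∉ F)
    (hu'c : Finset.univ \ u' ∉ F)
    (h : ∀ t ∈ F, Cells (F \\ F) t (if σ t = true then u else Finset.univ \ u))
    (h' : ∀ t ∈ F, Cells (F \\ F) t (if σ t = true then u' else Finset.univ \ u'))
    (hx : u \ u' ∈ F \\ F) (hy : u' \ u ∈ F \\ F) : u' = u := by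
  set G := F.image fun t => Finset.univ \ t with hG
  have hDG : G \\ G = insert ∅ G := by rw [hG, diffs_image_compl, hD]
  have hFG : F \\ F = G \\ G := by rw [hG, diffs_image_compl]
  -- transfer the hypotheses to `G` with the complemented sets and the sign pattern `σ ∘ compl`
  have key : ∀ (v : Finset α), (∀ t ∈ F, Cells (F \\ F) t (if σ t = true then v else Finset.univ \ v)) →
      ∀ t ∈ G, Cells (G \\ G) t
        (if σ (Finset.univ \ t) = true then Finset.univ \ v else Finset.univ \ (Finset.univ \ v)) := by
    intro v hv t ht
    obtain ⟨s, hs, rfl⟩ := mem_image.1 ht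
    rw [Finset.sdiff_sdiff_eq_self (subset_univ s), Finset.sdiff_sdiff_eq_self (subset_univ v),
      ← hFG]
    have := hv s hs
    by_cases hσ : σ s = true
    · rw [if_pos hσ] at this ⊢
      exact (cells_compl_iff _ _ _).2 this
    · rw [if_neg hσ] at this ⊢
      have h2 := (cells_compl_iff (F \\ F) s (Finset.univ \ v)).2 this
      rwa [Finset.sdiff_sdiff_eq_self (subset_univ v)] at h2
  have hu₁ : Finset.univ \ u ∉ G := fun h => hu (by
    rw [mem_image_compl_iff, Finset.sdiff_sdiff_eq_self (subset_univ u)] at h; exact h)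
  have hu₁c : Finset.univ \ (Finset.univ \ u) ∉ G := fun h => huc (by
    rw [Finset.sdiff_sdiff_eq_self (subset_univ u)] at h; exact mem_image_compl_iff.1 h)
  have hu₂ : Finset.univ \ u' ∉ G := fun h => hu' (by
    rw [mem_image_compl_iff, Finset.sdiff_sdiff_eq_self (subset_univ u')] at h; exact h)
  have hu₂c : Finset.univ \ (Finset.univ \ u') ∉ G := fun h => hu'c (by
    rw [Finset.sdiff_sdiff_eq_self (subset_univ u')] at h; exact mem_image_compl_iff.1 h)
  have hx' : (Finset.univ \ u) \ (Finset.univ \ u') ∈ G \\ G := by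
    rw [← hFG]
    have e : (Finset.univ \ u) \ (Finset.univ \ u') = u' \ u := by ext x; simp [and_comm]
    rw [e]; exact hy
  have hy' : (Finset.univ \ u') \ (Finset.univ \ u) ∈ G \\ G := by
    rw [← hFG]
    have e : (Finset.univ \ u') \ (Finset.univ \ u) = u \ u' := by ext x; simp [and_comm]
    rw [e]; exact hx
  have := eq_of_diffs_eq_insert_empty hDG (fun t => σ (Finset.univ \ t)) hu₁ hu₁c hu₂ hu₂c
    (key u h) (key u' h') hx' hy'
  have := congrArg (fun s => Finset.univ \ s) this
  simpa [Finset.sdiff_sdiff_eq_self (subset_univ u), Finset.sdiff_sdiff_eq_self (subset_univ u')]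
    using this

end PercRepro.MSTight
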